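import Literature.NumberTheory.Sieve.LargestPrimeFactorCubicSawtoothSums
import Mathlib.Data.Int.CardIntervalMod
import HarnessLib

/-!
# Heath-Brown 2001, Lemma 4 (second part): the remainders `R_J` of a family as sawtooth sums,
# and the passage to the exponential sums `σ(n)` by (3.5)

Tenth proved layer of this seat under the named fact `HeathBrown2001_largestPrimeFactor_cubic`
(`LargestPrimeFactorCubic.lean`; D. R. Heath-Brown, *The largest prime factor of `X³ + 2`*, Proc.
London Math. Soc. (3) 82 (2001) 554–596), continuing `…SawtoothSums`.  In the proof of Lemma 4
(p. 566), for an ideal `J` with `ρ(J) = 1` and root class `k = k_J`,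

> `#𝒜_J = #{n : X < n ≤ 2X, n ≡ k (mod N(J))} = #{m : (X − k)/N(J) < m ≤ (2X − k)/N(J)}`
> `= X/N(J) + ψ((X − k)/N(J)) − ψ((2X − k)/N(J))`, `ψ(t) = t − [t] − 1/2`,

so that `∑_{J ∈ 𝒥} R_J` is a difference of two sums of `ψ` over the points `t_J = (X' − k_J)/N(J)`,
`X' = X` or `2X`, each bounded by `…SawtoothSums.abs_sum_saw_le` in terms of
`Σ(n) = ∑_J e(n(X' − k_J)/N(J))`; and (p. 568) "it now follows from (3.5) that
`e_{N(J)}(n(X' − k_J)) = e_q(−nab C̄) e(nX'/N(α)) + O(n N³ M⁻⁶)`, so that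
`Σ(n) = σ(n) + O(n N³M⁻⁶ #𝒥)`".  This file PROVES these two steps for an arbitrary finite family:

* `card_filter_dvd_sub_real_eq` — `#{X < n ≤ 2X : N ∣ n − k} − X/N = ψ((X − k)/N) − ψ((2X − k)/N)`
  (exact, `N ≥ 1`, any `k ∈ ℤ`; Mathlib's `Nat.Ioc_filter_modEq_card` and `[y] = y − 1/2 − ψ(y)`);
* `abs_sum_remainder_le` — for a family `(N_j, k_j)`,
  `|∑_j (#{X < n ≤ 2X : N_j ∣ n − k_j} − X/N_j)| ≤ ∑_{X' ∈ {X, 2X}} [bound of abs_sum_saw_le at the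
  points (X' − k_j)/N_j]`;
* `norm_sum_fourierChar_sub_le` — if `e(h t_j) = e(h t'_j) e(h ε_j)` then
  `|∑_j e(h t_j) − ∑_j e(h t'_j)| ≤ 2π|h| ∑_j |ε_j|` (the `O(n N³M⁻⁶ #𝒥)` step, with
  `ε_J = −E/(qN(J))` from (3.5): `−k_J/N(J) ≡ −abw/q − E/(qN(J)) (mod 1)`).

## References

* D. R. Heath-Brown, *The largest prime factor of `X³ + 2`*, Proc. London Math. Soc. (3) 82 (2001)
  554–596, §3 pp. 566–568, (3.4)–(3.5) and (2.9). [`HeathBrown2001LargestPrimeFactorCubic`]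
-/

noncomputable section

open Finset Real
open scoped FourierTransform

namespace Literature.NumberTheory.Sieve.LargestPrimeFactorCubic

open Literature.NumberTheory.LFunctions.AFE (saw saw_def)

/-! ### Counting an arithmetic progression in `(X, 2X]` -/

/-- `[y] = y − 1/2 − ψ(y)`. [folklore] -/
theorem floor_eq_sub_saw (y : ℝ) : (⌊y⌋ : ℝ) = y - 1 / 2 - saw y := by
  rw [saw_def]
  have := Int.fract_add_floor y
  linarith

/-- `ψ` is `1`-periodic: `ψ(y + m) = ψ(y)` for `m ∈ ℤ`. [folklore] -/
theorem saw_add_intCast (y : ℝ) (m : ℤ) : saw (y + m) = saw y := by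
  rw [saw_def, saw_def, Int.fract_add_intCast]

/-- If `N ∣ a − b` then `ψ((x − a)/N) = ψ((x − b)/N)`. [folklore] -/
theorem saw_div_congr {N : ℕ} (hN : 0 < N) {a b : ℤ} (h : (N : ℤ) ∣ a - b) (x : ℝ) :
    saw ((x - a) / N) = saw ((x - b) / N) := by
  obtain ⟨m, hm⟩ := h
  have hN0 : (N : ℝ) ≠ 0 := by exact_mod_cast hN.ne'
  have e : (x - b) / N = (x - a) / N + (m : ℝ) := by
    have : (a : ℝ) - b = N * m := by exact_mod_cast hm
    field_simp
    linarith
  rw [e, saw_add_intCast]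

/-- **`#𝒜_J` exactly**: for `N ≥ 1`, `k ∈ ℤ` and `X ∈ ℕ`,
`#{X < n ≤ 2X : N ∣ n − k} = [(2X − k)/N] − [(X − k)/N]` ("`= #{m : (X−k)/N < m ≤ (2X−k)/N}`",
p. 566). [cite: HeathBrown2001LargestPrimeFactorCubic, §3 p. 566] -/
theorem card_filter_dvd_sub_eq {N : ℕ} (hN : 0 < N) (k : ℤ) (X : ℕ) :
    (#((Ioc X (2 * X)).filter fun n : ℕ => (N : ℤ) ∣ (n : ℤ) - k) : ℤ) =
      ⌊((2 * X : ℕ) - k : ℝ) / N⌋ - ⌊((X : ℕ) - k : ℝ) / N⌋ := by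
  -- the natural representative of `k mod N`
  set v : ℕ := (k % N).toNat with hv
  have hv0 : (0 : ℤ) ≤ k % N := Int.emod_nonneg _ (by exact_mod_cast hN.ne')
  have hvk : (v : ℤ) = k % N := by rw [hv, Int.toNat_of_nonneg hv0]
  have hdvd : (N : ℤ) ∣ k - v := ⟨k / N, by rw [hvk]; linarith [Int.mul_ediv_add_emod k N]⟩
  -- the two filters agree
  have hfilter : ((Ioc X (2 * X)).filter fun n : ℕ => (N : ℤ) ∣ (n : ℤ) - k) =
      ((Ioc X (2 * X)).filter fun n : ℕ => n ≡ v [MOD N]) := by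
    refine filter_congr (fun n _ => ?_)
    rw [Nat.ModEq.comm, Nat.modEq_iff_dvd]
    constructor
    · intro h
      have h2 := dvd_add h hdvd
      have e : (n : ℤ) - k + (k - v) = n - v := by ring
      rwa [e] at h2
    · intro h
      have h2 := dvd_sub h hdvd
      have e : (n : ℤ) - v - (k - v) = n - k := by ring
      rwa [e] at h2
  rw [hfilter, Nat.Ioc_filter_modEq_card _ _ hN v]
  -- the `max … 0` is the first argument
  have hmono : ⌊((X : ℕ) - v : ℚ) / N⌋ ≤ ⌊((2 * X : ℕ) - v : ℚ) / N⌋ := by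
    refine Int.floor_le_floor (div_le_div_of_nonneg_right ?_ (by positivity))
    push_cast; linarith [(Nat.cast_nonneg X : (0 : ℚ) ≤ X)]
  rw [max_eq_left (by linarith)]
  -- the `ℚ`-floors are `ℝ`-floors, and shifting `v` to `k` changes both floors by `(k − v)/N ∈ ℤ`
  obtain ⟨m, hm⟩ := hdvd
  have hN0 : (N : ℝ) ≠ 0 := by exact_mod_cast hN.ne'
  have hshift : ∀ Y : ℕ, ⌊((Y : ℕ) - v : ℚ) / N⌋ = ⌊((Y : ℕ) - k : ℝ) / N⌋ + m := by
    intro Y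
    rw [← Rat.floor_cast (α := ℝ)]
    push_cast
    have e : ((Y : ℝ) - v) / N = ((Y : ℝ) - k) / N + (m : ℝ) := by
      have : (k : ℝ) - v = N * m := by exact_mod_cast hm
      field_simp
      linarith
    rw [e, Int.floor_add_intCast]
  rw [hshift, hshift]
  push_cast
  ring

/-- **`R_J` as a difference of sawtooth values**:
`#{X < n ≤ 2X : N ∣ n − k} − X/N = ψ((X − k)/N) − ψ((2X − k)/N)` (p. 566).
[cite: HeathBrown2001LargestPrimeFactorCubic, §3 p. 566] -/
theorem card_filter_dvd_sub_real_eq {N : ℕ} (hN : 0 < N) (k : ℤ) (X : ℕ) :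
    (#((Ioc X (2 * X)).filter fun n : ℕ => (N : ℤ) ∣ (n : ℤ) - k) : ℝ) - X / N =
      saw (((X : ℕ) - k : ℝ) / N) - saw (((2 * X : ℕ) - k : ℝ) / N) := by
  have h := card_filter_dvd_sub_eq hN k X
  have h' : (#((Ioc X (2 * X)).filter fun n : ℕ => (N : ℤ) ∣ (n : ℤ) - k) : ℝ) =
      (⌊((2 * X : ℕ) - k : ℝ) / N⌋ : ℝ) - (⌊((X : ℕ) - k : ℝ) / N⌋ : ℝ) := by
    have := congrArg (Int.cast : ℤ → ℝ) h
    push_cast at this ⊢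
    linarith
  rw [h', floor_eq_sub_saw, floor_eq_sub_saw]
  have hN0 : (N : ℝ) ≠ 0 := by exact_mod_cast hN.ne'
  push_cast
  field_simp
  ring

/-! ### The remainders of a family -/

/-- **The remainder sum of a family as two sawtooth sums**: for a finite family of progressions
`n ≡ k_j (mod N_j)` (`N_j ≥ 1`),
`∑_j (#{X < n ≤ 2X : N_j ∣ n − k_j} − X/N_j) = ∑_j ψ((X − k_j)/N_j) − ∑_j ψ((2X − k_j)/N_j)`.
[cite: HeathBrown2001LargestPrimeFactorCubic, §3 p. 566] -/
theorem sum_remainder_eq {ι : Type*} (s : Finset ι) (Nf : ι → ℕ) (kf : ι → ℤ)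
    (hN : ∀ j ∈ s, 0 < Nf j) (X : ℕ) :
    ∑ j ∈ s, ((#((Ioc X (2 * X)).filter fun n : ℕ => (Nf j : ℤ) ∣ (n : ℤ) - kf j) : ℝ) - X / Nf j) =
      ∑ j ∈ s, saw (((X : ℕ) - kf j : ℝ) / Nf j) - ∑ j ∈ s, saw (((2 * X : ℕ) - kf j : ℝ) / Nf j) := by
  rw [← sum_sub_distrib]
  exact sum_congr rfl (fun j hj => card_filter_dvd_sub_real_eq (hN j hj) (kf j) X)

/-- **Lemma 4, second part, first form** ((2.9) before (3.5)): with `S_{X'}(d) = ∑_j e(d (X' − k_j)/N_j)`,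
`V ≥ 1`, `H = 5(2V+1)`, `c_V = 3(2 + log(2V+1))/(2V+1)`,
`|∑_j R_j| ≤ ∑_{X' ∈ {X, 2X}} [(1/π)∑_{ν≤V} |S_{X'}(ν)|/ν + c_V ∑_{|d| ≤ H} |S_{X'}(d)|]`.
[cite: HeathBrown2001LargestPrimeFactorCubic, Lemma 4 (2.9)] -/
theorem abs_sum_remainder_le {ι : Type*} (s : Finset ι) (Nf : ι → ℕ) (kf : ι → ℤ)
    (hN : ∀ j ∈ s, 0 < Nf j) (X : ℕ) {V : ℕ} (hV : 1 ≤ V) :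
    |∑ j ∈ s, ((#((Ioc X (2 * X)).filter fun n : ℕ => (Nf j : ℤ) ∣ (n : ℤ) - kf j) : ℝ) - X / Nf j)| ≤
      ((1 / π) * ∑ ν ∈ Icc 1 V, ‖∑ j ∈ s, (𝐞 ((ν : ℝ) * ((((X : ℕ) : ℝ) - kf j) / Nf j)) : ℂ)‖ / ν +
        3 * (2 + Real.log (2 * V + 1)) / (2 * V + 1) *
          ∑ d ∈ Icc (-((5 * (2 * V + 1) : ℕ) : ℤ)) (5 * (2 * V + 1) : ℕ),
            ‖∑ j ∈ s, (𝐞 ((d : ℝ) * ((((X : ℕ) : ℝ) - kf j) / Nf j)) : ℂ)‖) +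
      ((1 / π) * ∑ ν ∈ Icc 1 V, ‖∑ j ∈ s, (𝐞 ((ν : ℝ) * ((((2 * X : ℕ) : ℝ) - kf j) / Nf j)) : ℂ)‖ / ν +
        3 * (2 + Real.log (2 * V + 1)) / (2 * V + 1) *
          ∑ d ∈ Icc (-((5 * (2 * V + 1) : ℕ) : ℤ)) (5 * (2 * V + 1) : ℕ),
            ‖∑ j ∈ s, (𝐞 ((d : ℝ) * ((((2 * X : ℕ) : ℝ) - kf j) / Nf j)) : ℂ)‖) := by
  rw [sum_remainder_eq s Nf kf hN X]
  refine (abs_sub _ _).trans (add_le_add ?_ ?_)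
  · exact abs_sum_saw_le s (fun j => (((X : ℕ) : ℝ) - kf j) / Nf j) hV
  · exact abs_sum_saw_le s (fun j => (((2 * X : ℕ) : ℝ) - kf j) / Nf j) hV

/-! ### Replacing the phases: the `O(n N³M⁻⁶ #𝒥)` step -/

/-- `|e(x) − e(y)| ≤ 2π|x − y|`. [folklore] -/
theorem norm_fourierChar_sub_fourierChar_le (x y : ℝ) :
    ‖(𝐞 x : ℂ) - 𝐞 y‖ ≤ 2 * π * |x - y| := by
  have h1 : (𝐞 x : ℂ) - 𝐞 y = 𝐞 y * ((𝐞 (x - y) : ℂ) - 1) := by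
    rw [mul_sub, mul_one, ← Circle.coe_mul, ← AddChar.map_add_eq_mul, add_sub_cancel]
  rw [h1, norm_mul, Vinogradov.norm_fourierChar, one_mul, Vinogradov.norm_fourierChar_sub_one]
  have h2 : |Real.sin (π * (x - y))| ≤ π * |x - y| := by
    refine Real.abs_sin_le_abs.trans (le_of_eq ?_)
    rw [abs_mul, abs_of_pos Real.pi_pos]
  linarith

/-- If `t_j − t'_j − ε_j ∈ ℤ` for all `j` then, for every integer `h`,
`|∑_j e(h t_j) − ∑_j e(h t'_j)| ≤ 2π|h| ∑_j |ε_j|` ("`e_{N(J)}(n(X' − k_J)) = e_q(−nabC̄) e(nX'/N(α))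
+ O(nN³M⁻⁶)`, p. 568). [cite: HeathBrown2001LargestPrimeFactorCubic, §3 p. 568] -/
theorem norm_sum_fourierChar_sub_le {ι : Type*} (s : Finset ι) (t t' ε : ι → ℝ)
    (hint : ∀ j ∈ s, ∃ m : ℤ, t j - t' j - ε j = m) (h : ℤ) :
    ‖∑ j ∈ s, (𝐞 ((h : ℝ) * t j) : ℂ) - ∑ j ∈ s, (𝐞 ((h : ℝ) * t' j) : ℂ)‖ ≤
      2 * π * |(h : ℝ)| * ∑ j ∈ s, |ε j| := by
  rw [← sum_sub_distrib, mul_sum]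
  refine (norm_sum_le _ _).trans (sum_le_sum (fun j hj => ?_))
  obtain ⟨m, hm⟩ := hint j hj
  -- `e(h t_j) = e(h (t'_j + ε_j))` as `h(t_j − t'_j − ε_j) = hm ∈ ℤ`
  have e1 : (𝐞 ((h : ℝ) * t j) : ℂ) = 𝐞 ((h : ℝ) * (t' j + ε j)) := by
    have : (h : ℝ) * t j = (h : ℝ) * (t' j + ε j) + ((h * m : ℤ) : ℝ) := by
      push_cast
      linear_combination (h : ℝ) * hm
    rw [this, FejerCounting.fourierChar_add_intCast]
  rw [e1]
  refine (norm_fourierChar_sub_fourierChar_le _ _).trans (le_of_eq ?_)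
  rw [show (h : ℝ) * (t' j + ε j) - h * t' j = h * ε j by ring, abs_mul]
  ring

end Literature.NumberTheory.Sieve.LargestPrimeFactorCubic
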